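import Summits.PneNP.PneNP.Theses.Feige
import Literature.Computability.MetaComplexity.RandomCNFFirstMoment
import Literature.Computability.MetaComplexity.RandomScopes

/-!
# PneNP / Feige — `FirstMomentUnsat` (stmt-PneNP-1099): a random 3-CNF at density
`Δ > log 2 / log(8/7)` is unsatisfiable with high probability

Route `PneNP/Feige`, item stmt-PneNP-1099
(`Summit.PneNP.PneNP.Theses.Feige.FirstMomentUnsat`). The first-moment bound (Franco–Paull 1983;
Chvátal–Szemerédi 1988, §1; Feige 2002, p. 534, "(7/8)^Δ < 1/2"): among the `|kClauses 3 n|^m`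
clause tuples of `F₃(n, m)`, the satisfiable ones number at most `2^n (7 C(n,3))^m`
(`card_le_of_forall_satisfiable`, already in the tree), i.e. a `2^n (7/8)^m` fraction; with
`m = ⌈Δ n⌉ ≥ Δ n` this is at most `exp(-n (Δ log(8/7) - log 2)) → 0`.

* `randomKCNF_toOuterMeasure_le` — probability glue (upper bound of an event by a tuple count);
* `feige_firstMomentUnsat_proof` — the item.

References: J. Franco, M. Paull, Discrete Appl. Math. 5 (1983); V. Chvátal, E. Szemerédi, J. ACM 35
(1988), §1; U. Feige, STOC 2002, p. 534.
-/

namespace Summit.PneNP.PneNP.Theorems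

open Filter Topology MeasureTheory Finset
open Literature.Computability.Complexity Literature.Computability.MetaComplexity

/-- **Probability glue (upper bound).** If `kClauses k n ≠ ∅` and a finset `B` of clause tuples
contains every tuple whose listed formula lies in the event `E`, and `|B| ≤ β · |kClauses k n|^m`,
then `Pr_{φ ∼ F_k(n,m)}[E] ≤ β`. [folklore] -/
theorem randomKCNF_toOuterMeasure_le {k n m : ℕ} (h : (kClauses k n).Nonempty) {E : Set (CNF ℕ)}
    {β : ℝ} (hβ : 0 ≤ β) (B : Finset (Fin m → ↥(kClauses k n)))
    (hB : ∀ c : Fin m → ↥(kClauses k n),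
      (List.ofFn fun i => ((c i : ↥(kClauses k n)) : Clause ℕ)) ∈ E → c ∈ B)
    (hcard : (B.card : ℝ) ≤ β * (((kClauses k n).card ^ m : ℕ) : ℝ)) :
    (randomKCNF k n m).toOuterMeasure E ≤ ENNReal.ofReal β := by
  classical
  haveI : Nonempty ↥(kClauses k n) := h.coe_sort
  have hrw : randomKCNF k n m = (PMF.uniformOfFintype (Fin m → ↥(kClauses k n))).map
      fun c => List.ofFn fun i => (c i : Clause ℕ) := by
    unfold randomKCNF
    rw [dif_pos h]
  rw [hrw, PMF.toOuterMeasure_map_apply]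
  set μ := (PMF.uniformOfFintype (Fin m → ↥(kClauses k n))).toOuterMeasure with hμ
  have h1 : μ ((fun c => List.ofFn fun i => (c i : Clause ℕ)) ⁻¹' E) ≤ μ ↑B :=
    measure_mono fun c hc => by simpa using hB c hc
  have h2 : μ ↑B ≤ ENNReal.ofReal β := by
    have h3 : μ ↑B = (B.card : ENNReal) / (((kClauses k n).card ^ m : ℕ) : ENNReal) := by
      rw [hμ, PMF.toOuterMeasure_uniformOfFintype_apply, ← Set.toFinset_card, Finset.toFinset_coe,
        Fintype.card_fun, Fintype.card_fin, Fintype.card_coe]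
    rw [h3]
    refine ENNReal.div_le_of_le_mul ?_
    rw [← ENNReal.ofReal_natCast, ← ENNReal.ofReal_natCast, ← ENNReal.ofReal_mul hβ]
    exact ENNReal.ofReal_le_ofReal hcard
  exact h1.trans h2

/-- **`FirstMomentUnsat`** (item stmt-PneNP-1099 of route `PneNP/Feige`): for
`Δ > log 2 / log(8/7)`, `Pr_{φ ∼ F₃(n, ⌈Δ n⌉)}[φ satisfiable] → 0`. For `n ≥ 3` the satisfiable
clause tuples are at most a `2^n (7/8)^{⌈Δn⌉} ≤ exp(-n (Δ log(8/7) - log 2))` fraction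
(`card_le_of_forall_satisfiable` and `randomKCNF_toOuterMeasure_le`), and the exponent is negative.
[Franco–Paull 1983; Chvátal–Szemerédi 1988, §1; Feige 2002, p. 534] -/
theorem feige_firstMomentUnsat_proof : Summit.PneNP.PneNP.Theses.Feige.FirstMomentUnsat := by
  unfold Summit.PneNP.PneNP.Theses.Feige.FirstMomentUnsat
  intro Δ hΔ
  have hlog87 : 0 < Real.log (8 / 7) := Real.log_pos (by norm_num)
  have hlog2 : 0 < Real.log 2 := Real.log_pos one_lt_two
  have hΔpos : 0 < Δ := lt_trans (div_pos hlog2 hlog87) hΔ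
  set θ : ℝ := Δ * Real.log (8 / 7) - Real.log 2 with hθdef
  have hθ : 0 < θ := by
    have := (div_lt_iff₀ hlog87).1 hΔ
    rw [hθdef]; linarith
  -- the bound for `n ≥ 3`
  have hbound : ∀ n : ℕ, 3 ≤ n →
      (randomKCNFAtDensity 3 Δ n).toOuterMeasure {φ | CNF.Satisfiable φ} ≤
        ENNReal.ofReal (Real.exp (-(θ * n))) := by
    intro n hn
    classical
    set m : ℕ := ⌈Δ * n⌉₊ with hm
    have hK : (kClauses 3 n).card = n.choose 3 * 2 ^ 3 := card_kClauses 3 n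
    have hch : 0 < n.choose 3 := Nat.choose_pos hn
    have hKne : (kClauses 3 n).Nonempty := by
      rw [← Finset.card_pos, hK]; positivity
    set bad : Finset (Fin m → ↥(kClauses 3 n)) :=
      univ.filter fun c => CNF.Satisfiable (List.ofFn fun i => (c i : Clause ℕ)) with hbad
    have hcount : bad.card ≤ 2 ^ n * (n.choose 3 * (2 ^ 3 - 1)) ^ m :=
      card_le_of_forall_satisfiable bad fun c hc => (mem_filter.1 hc).2
    set β : ℝ := 2 ^ n * (7 / 8 : ℝ) ^ m with hβ
    have hβ0 : 0 ≤ β := by positivity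
    have hP : (randomKCNFAtDensity 3 Δ n).toOuterMeasure {φ | CNF.Satisfiable φ} ≤
        ENNReal.ofReal β := by
      refine randomKCNF_toOuterMeasure_le hKne hβ0 bad (fun c hc => mem_filter.2 ⟨mem_univ _, hc⟩) ?_
      have h1 : (bad.card : ℝ) ≤ ((2 ^ n * (n.choose 3 * (2 ^ 3 - 1)) ^ m : ℕ) : ℝ) := by
        exact_mod_cast hcount
      refine h1.trans (le_of_eq ?_)
      rw [hK, hβ]
      push_cast
      rw [mul_assoc, ← mul_pow]
      norm_num
      ring
    refine hP.trans (ENNReal.ofReal_le_ofReal ?_)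
    -- `2^n (7/8)^m ≤ exp(-θ n)`
    have hmΔ : Δ * n ≤ (m : ℝ) := Nat.le_ceil _
    have h78 : (7 / 8 : ℝ) ^ m ≤ (7 / 8 : ℝ) ^ (Δ * n) := by
      rw [← Real.rpow_natCast]
      exact Real.rpow_le_rpow_of_exponent_ge (by norm_num) (by norm_num) hmΔ
    have hexp : (2 : ℝ) ^ n * (7 / 8 : ℝ) ^ (Δ * n) = Real.exp (-(θ * n)) := by
      rw [Real.rpow_def_of_pos (by norm_num), ← Real.rpow_natCast,
        Real.rpow_def_of_pos (by norm_num), ← Real.exp_add, hθdef]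
      have : Real.log (7 / 8) = -Real.log (8 / 7) := by
        rw [← Real.log_inv]; norm_num
      rw [this]
      ring_nf
    calc β = 2 ^ n * (7 / 8 : ℝ) ^ m := hβ
      _ ≤ 2 ^ n * (7 / 8 : ℝ) ^ (Δ * n) := mul_le_mul_of_nonneg_left h78 (by positivity)
      _ = Real.exp (-(θ * n)) := hexp
  -- the limit
  have hlim : Tendsto (fun n : ℕ => ENNReal.ofReal (Real.exp (-(θ * n)))) atTop (𝓝 0) := by
    rw [← ENNReal.ofReal_zero]
    refine ENNReal.tendsto_ofReal ?_
    have h1 : Tendsto (fun n : ℕ => θ * (n : ℝ)) atTop atTop :=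
      tendsto_natCast_atTop_atTop.const_mul_atTop hθ
    exact Real.tendsto_exp_neg_atTop_nhds_zero.comp h1
  refine tendsto_of_tendsto_of_tendsto_of_le_of_le' tendsto_const_nhds hlim
    (Eventually.of_forall fun _ => bot_le) (eventually_atTop.2 ⟨3, hbound⟩)

end Summit.PneNP.PneNP.Theorems
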